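import Mathlib
import Summits.Ventures.PercRepro2.Defs
import Summits.Ventures.PercRepro2.Graph
import Summits.Ventures.PercRepro2.OneColourSwitch
import Summits.Ventures.PercRepro2.RegionHubSign
import Summits.Ventures.PercRepro2.SideSwitch
import Summits.Ventures.PercRepro2.TermSwitchDefs
import Summits.Ventures.PercRepro2.M9NoPocketDefs
import Summits.Ventures.PercRepro2.M9PsiOneDefs
import Summits.Ventures.PercRepro2.M9PsiOneWorlds
import Summits.Ventures.PercRepro2.M9PsiTwoDefs

/-!
# The worlds of the second partner `Ψ₂ ω` and its legality (blind cell PercRepro2, p3 g34,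
2026-08-29; `proofs/P3-REST2.md` §1, claim (i))

For an `EX` colouring `ω` (`IsEX`), the second partner `ω' = psiTwo ω` has `Y`-world inside
`Zw = {r, s, d} ∪ Kcore ∪ flipSetW` (`K2_psiTwo_subset`: `Zw` is closed under the open edges of
`ω'`, by the colour table of `M9PsiTwoDefs`) and `W`-world inside `Tw = {r, s} ∪ (Mcore ∖ flipSetW)`
(`M2_psiTwo_subset`).  The `Y`-world of `ω` survives outside the `W`-core
(`mem_K2_psiTwo_of_mem_K2`), so `d ∈ K₂(Ψ₂ ω)` (`mem_K2_psiTwo`) while `d ∉ M₂(Ψ₂ ω)`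
(`not_mem_M2_psiTwo`).  Hence **`Ψ₂ ω` is `Sep ∧ DZero`** (`sep2_psiTwo`, `DZero_psiTwo`,
`DOne_psiTwo`): a legal one-sided `K`-point.  No case split on the pure case is needed: an edge
at `d` flipped by `Ψ₂` goes into a joined `W`-vertex, which lies in `Zw` either way.  Own work;
std axioms.
-/

namespace Summit.Ventures.PercRepro2

namespace NoPocket

open Finset Classical RegionHub OneColourSwitch SideSwitch TermSwitch

variable {V : Type*} {E : Type*}

section Sets

variable (ends : E → Sym2 V) (r s d : V) (ω : Config E)

/-- The candidate `Y`-world of `Ψ₂ ω`: the terminals, `d`, the whole `Y`-core and the flipped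
`W`-vertices. -/
def Zw : Set V := ({r, s, d} : Set V) ∪ Kcore ends r s d ω ∪ flipSetW ends r s d ω

/-- The candidate `W`-world of `Ψ₂ ω`: the terminals and the `W`-core vertices that are not
flipped. -/
def Tw : Set V := ({r, s} : Set V) ∪ {x | x ∈ Mcore ends r s d ω ∧ x ∉ flipSetW ends r s d ω}

end Sets

section Helpers

variable {ends : E → Sym2 V} {r s d : V} {ω : Config E}

/-- `r` lies in every `W`-world. -/
lemma r_mem_M2 (ω₀ : Config E) : r ∈ M2 ends r s ω₀ := r_mem_K2 (OneColourSwitch.compl ω₀)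

/-- `s` lies in every `W`-world. -/
lemma s_mem_M2 (ω₀ : Config E) : s ∈ M2 ends r s ω₀ := s_mem_K2 (OneColourSwitch.compl ω₀)

/-- Membership of a terminal in `Zw`. -/
lemma term_mem_Zw {t : V} (ht : t = r ∨ t = s) : t ∈ Zw ends r s d ω := by
  rcases ht with rfl | rfl
  · exact Or.inl (Or.inl (by simp))
  · exact Or.inl (Or.inl (by simp))

/-- `d ∈ Zw`. -/
lemma d_mem_Zw : d ∈ Zw ends r s d ω := Or.inl (Or.inl (by simp))

/-- The `Y`-core lies in `Zw`. -/
lemma mem_Zw_of_mem_Kcore {x : V} (hx : x ∈ Kcore ends r s d ω) : x ∈ Zw ends r s d ω :=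
  Or.inl (Or.inr hx)

/-- The flipped set lies in `Zw`. -/
lemma mem_Zw_of_mem_flipSetW {x : V} (hx : x ∈ flipSetW ends r s d ω) : x ∈ Zw ends r s d ω :=
  Or.inr hx

/-- Membership of a terminal in `Tw`. -/
lemma term_mem_Tw {t : V} (ht : t = r ∨ t = s) : t ∈ Tw ends r s d ω := by
  rcases ht with rfl | rfl
  · exact Or.inl (by simp)
  · exact Or.inl (by simp)

/-- An unflipped `W`-core vertex lies in `Tw`. -/
lemma mem_Tw_of_Mcore {x : V} (hx : x ∈ Mcore ends r s d ω) (hx' : x ∉ flipSetW ends r s d ω) :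
    x ∈ Tw ends r s d ω :=
  Or.inr ⟨hx, hx'⟩

/-- A `W`-core vertex adjacent to `d` is flipped. -/
lemma mem_flipSetW_of_adj_d {x : V} {e : E} (hx : x ∈ Mcore ends r s d ω)
    (hends : ends e = s(x, d)) : x ∈ flipSetW ends r s d ω :=
  mem_flipSetW_of_nbr hx (ends_swap hends)

end Helpers

section Worlds

variable {ends : E → Sym2 V} {p q r s d : V} {ω : Config E}

variable (h : IsEX ends p q r s d ω)
include h

/-- The colour of `Ψ₂ ω` on an edge from a terminal into the `Y`-core: open. -/
lemma psiTwo_term_Kcore {t y : V} {e : E} (ht : t = r ∨ t = s) (hy : y ∈ Kcore ends r s d ω)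
    (hends : ends e = s(t, y)) : psiTwo ends r s d ω e = true := by
  rw [psiTwo_Kcore h hy (ends_swap hends)]
  exact edge_Kcore_term h hy ht (ends_swap hends)

/-- The colour of `Ψ₂ ω` on an edge from a terminal into the `W`-core: open iff the core end
is flipped. -/
lemma psiTwo_term_Mcore {t y : V} {e : E} (ht : t = r ∨ t = s) (hy : y ∈ Mcore ends r s d ω)
    (hends : ends e = s(t, y)) :
    psiTwo ends r s d ω e = (if y ∈ flipSetW ends r s d ω then true else false) := by
  by_cases hyF : y ∈ flipSetW ends r s d ω
  · rw [if_pos hyF]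
    exact psiTwo_flip_term_eq_true h hyF ht (ends_swap hends)
  · rw [if_neg hyF, psiTwo_Mcore_kept h hy hyF (ends_swap hends)]
    exact edge_Mcore_term h hy ht (ends_swap hends)

/-- **`Zw` is closed under the open edges of `Ψ₂ ω`.** -/
lemma Zw_closed :
    ∀ x ∈ Zw ends r s d ω, ∀ y, (openGraph ends (psiTwo ends r s d ω)).Adj x y →
      y ∈ Zw ends r s d ω := by
  intro x hx y hxy
  obtain ⟨hne, e, he, hends⟩ := openGraph_adj.1 hxy
  rcases vertex_cases (ends := ends) (r := r) (s := s) (d := d) (ω := ω) y with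
    hy | hy | hy | hyK | hyM | hyO
  · exact hy ▸ term_mem_Zw (Or.inl rfl)
  · exact hy ▸ term_mem_Zw (Or.inr rfl)
  · exact hy ▸ d_mem_Zw
  · exact mem_Zw_of_mem_Kcore hyK
  · -- `y` in the `W`-core: it must be flipped
    refine mem_Zw_of_mem_flipSetW ?_
    rcases hx with (hxT | hxK) | hxF
    · simp only [Set.mem_insert_iff, Set.mem_singleton_iff] at hxT
      rcases hxT with hx | hx | hx
      · by_contra hyF
        rw [psiTwo_term_Mcore h (Or.inl hx) hyM hends, if_neg hyF] at he
        exact Bool.false_ne_true he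
      · by_contra hyF
        rw [psiTwo_term_Mcore h (Or.inr hx) hyM hends, if_neg hyF] at he
        exact Bool.false_ne_true he
      · exact mem_flipSetW_of_nbr hyM (hx ▸ hends)
    · exact (no_edge_core_core h hxK hyM hends).elim
    · exact mem_flipSetW_of_edge hxF hyM hends
  · exfalso
    rcases hx with (hxT | hxK) | hxF
    · simp only [Set.mem_insert_iff, Set.mem_singleton_iff] at hxT
      rcases hxT with hx | hx | hx
      · exact no_edge_out_term h hyO (Or.inl hx) hends
      · exact no_edge_out_term h hyO (Or.inr hx) hends
      · exact no_edge_d_out h hyO (hx ▸ hends)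
    · rw [psiTwo_Kcore h hxK hends, edge_Kcore_out hxK hyO hends] at he
      exact Bool.false_ne_true he
    · rw [psiTwo_flip_out_eq_false h hxF hyO hends] at he
      exact Bool.false_ne_true he

/-- **`K₂(Ψ₂ ω) ⊆ Zw`.** -/
theorem K2_psiTwo_subset : K2 ends r s (psiTwo ends r s d ω) ⊆ Zw ends r s d ω := by
  intro x hx
  rcases mem_K2_iff.1 hx with hc | hc
  · exact mem_of_conn_of_closed (Zw_closed h) (term_mem_Zw (Or.inl rfl)) hc
  · exact mem_of_conn_of_closed (Zw_closed h) (term_mem_Zw (Or.inr rfl)) hc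

/-- **`Tw` is closed under the closed edges of `Ψ₂ ω`.** -/
lemma Tw_closed :
    ∀ x ∈ Tw ends r s d ω, ∀ y,
      (openGraph ends (OneColourSwitch.compl (psiTwo ends r s d ω))).Adj x y →
        y ∈ Tw ends r s d ω := by
  intro x hx y hxy
  obtain ⟨hne, e, he, hends⟩ := openGraph_adj.1 hxy
  have he' : psiTwo ends r s d ω e = false := by
    simpa [OneColourSwitch.compl] using he
  rcases vertex_cases (ends := ends) (r := r) (s := s) (d := d) (ω := ω) y with
    hy | hy | hy | hyK | hyM | hyO
  · exact hy ▸ term_mem_Tw (Or.inl rfl)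
  · exact hy ▸ term_mem_Tw (Or.inr rfl)
  · exfalso
    rcases hx with hxT | ⟨hxM, hxF⟩
    · simp only [Set.mem_insert_iff, Set.mem_singleton_iff] at hxT
      rcases hxT with hx | hx
      · exact no_edge_d_term h (Or.inl hx) (ends_swap (hy ▸ hends))
      · exact no_edge_d_term h (Or.inr hx) (ends_swap (hy ▸ hends))
    · exact hxF (mem_flipSetW_of_adj_d hxM (hy ▸ hends))
  · exfalso
    rcases hx with hxT | ⟨hxM, _⟩
    · simp only [Set.mem_insert_iff, Set.mem_singleton_iff] at hxT
      rcases hxT with hx | hx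
      · rw [psiTwo_term_Kcore h (Or.inl hx) hyK hends] at he'
        exact (Bool.false_ne_true he'.symm).elim
      · rw [psiTwo_term_Kcore h (Or.inr hx) hyK hends] at he'
        exact (Bool.false_ne_true he'.symm).elim
    · exact no_edge_core_core h hyK hxM (ends_swap hends)
  · refine mem_Tw_of_Mcore hyM ?_
    rcases hx with hxT | ⟨hxM, hxF⟩
    · simp only [Set.mem_insert_iff, Set.mem_singleton_iff] at hxT
      intro hyF
      rcases hxT with hx | hx
      · rw [psiTwo_term_Mcore h (Or.inl hx) hyM hends, if_pos hyF] at he'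
        exact Bool.false_ne_true he'.symm
      · rw [psiTwo_term_Mcore h (Or.inr hx) hyM hends, if_pos hyF] at he'
        exact Bool.false_ne_true he'.symm
    · intro hyF
      exact hxF (mem_flipSetW_of_edge' hyF hxM hends)
  · exfalso
    rcases hx with hxT | ⟨hxM, hxF⟩
    · simp only [Set.mem_insert_iff, Set.mem_singleton_iff] at hxT
      rcases hxT with hx | hx
      · exact no_edge_out_term h hyO (Or.inl hx) hends
      · exact no_edge_out_term h hyO (Or.inr hx) hends
    · rw [psiTwo_Mcore_kept h hxM hxF hends, edge_Mcore_out hxM hyO hends] at he'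
      exact Bool.false_ne_true he'.symm

/-- **`M₂(Ψ₂ ω) ⊆ Tw`.** -/
theorem M2_psiTwo_subset : M2 ends r s (psiTwo ends r s d ω) ⊆ Tw ends r s d ω := by
  intro x hx
  rcases mem_M2_iff.1 hx with hc | hc
  · exact mem_of_conn_of_closed (Tw_closed h) (term_mem_Tw (Or.inl rfl)) hc
  · exact mem_of_conn_of_closed (Tw_closed h) (term_mem_Tw (Or.inr rfl)) hc

/-- `d` is not in the `W`-world of `Ψ₂ ω`. -/
theorem not_mem_M2_psiTwo : d ∉ M2 ends r s (psiTwo ends r s d ω) := by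
  intro hd
  rcases M2_psiTwo_subset h hd with hT | ⟨hM, _⟩
  · simp only [Set.mem_insert_iff, Set.mem_singleton_iff] at hT
    rcases hT with hT | hT
    · exact h.hr hT
    · exact h.hs hT
  · exact d_not_mem_Mcore hM

/-- The survival set: `K₂(Ψ₂ ω) ∪ Mcore ∪ Outside`. -/
def Sw (ends : E → Sym2 V) (r s d : V) (ω : Config E) : Set V :=
  {z | z ∈ K2 ends r s (psiTwo ends r s d ω) ∨ z ∈ Mcore ends r s d ω ∨ z ∈ Outside ends r s ω}

/-- A `Y`-core vertex of the survival set is in `K₂(Ψ₂ ω)`. -/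
lemma mem_K2_psiTwo_of_mem_Sw_Kcore {x : V} (hx : x ∈ Sw ends r s d ω)
    (hxK : x ∈ Kcore ends r s d ω) : x ∈ K2 ends r s (psiTwo ends r s d ω) := by
  rcases hx with hx | hx | hx
  · exact hx
  · exact (not_mem_Mcore_of_mem_Kcore h.done hxK hx).elim
  · exact (hx.1 hxK.1).elim

/-- `d` in the survival set is in `K₂(Ψ₂ ω)`. -/
lemma mem_K2_psiTwo_of_mem_Sw_d (hx : d ∈ Sw ends r s d ω) :
    d ∈ K2 ends r s (psiTwo ends r s d ω) := by
  rcases hx with hx | hx | hx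
  · exact hx
  · exact (d_not_mem_Mcore hx).elim
  · exact (hx.1 h.inK).elim

/-- **The survival set is closed under the open edges of `ω`.** -/
lemma Sw_closed :
    ∀ x ∈ Sw ends r s d ω, ∀ y, (openGraph ends ω).Adj x y → y ∈ Sw ends r s d ω := by
  intro x hx y hxy
  obtain ⟨hne, e, he, hends⟩ := openGraph_adj.1 hxy
  rcases vertex_cases (ends := ends) (r := r) (s := s) (d := d) (ω := ω) y with
    hy | hy | hy | hyK | hyM | hyO
  · exact Or.inl (hy ▸ r_mem_K2 _)
  · exact Or.inl (hy ▸ s_mem_K2 _)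
  · -- `y = d`: `x` is a `Y`-core vertex in `K₂(Ψ₂ ω)`; the kept open edge carries `d`
    left
    rw [hy] at hends ⊢
    rcases vertex_cases (ends := ends) (r := r) (s := s) (d := d) (ω := ω) x with
      hx' | hx' | hx' | hxK | hxM | hxO
    · exact (no_edge_d_term h (Or.inl hx') (ends_swap hends)).elim
    · exact (no_edge_d_term h (Or.inr hx') (ends_swap hends)).elim
    · exact (hne (hx'.trans hy.symm)).elim
    · have hxK' := mem_K2_psiTwo_of_mem_Sw_Kcore h hx hxK
      have he' : psiTwo ends r s d ω e = true := by
        rw [psiTwo_d_Kcore h hxK (ends_swap hends)]; exact he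
      exact mem_K2_of_open hxK' he' hends
    · rw [edge_Mcore_d h hxM hends] at he; exact (Bool.false_ne_true he).elim
    · exact (no_edge_d_out h hxO (ends_swap hends)).elim
  · left
    have he' : psiTwo ends r s d ω e = true := by
      rw [psiTwo_Kcore h hyK (ends_swap hends)]; exact he
    rcases vertex_cases (ends := ends) (r := r) (s := s) (d := d) (ω := ω) x with
      hx' | hx' | hx' | hxK | hxM | hxO
    · exact mem_K2_of_open (hx' ▸ r_mem_K2 _) he' hends
    · exact mem_K2_of_open (hx' ▸ s_mem_K2 _) he' hends
    · rw [hx'] at hx hends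
      exact mem_K2_of_open (mem_K2_psiTwo_of_mem_Sw_d h hx) he' hends
    · exact mem_K2_of_open (mem_K2_psiTwo_of_mem_Sw_Kcore h hx hxK) he' hends
    · exact (no_edge_core_core h hyK hxM (ends_swap hends)).elim
    · rw [edge_Kcore_out hyK hxO (ends_swap hends)] at he; exact (Bool.false_ne_true he).elim
  · exact Or.inr (Or.inl hyM)
  · exact Or.inr (Or.inr hyO)

/-- **A `Y`-world vertex of `ω` is in the `Y`-world of `Ψ₂ ω`.** -/
theorem mem_K2_psiTwo_of_mem_K2 {x : V} (hx : x ∈ K2 ends r s ω) :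
    x ∈ K2 ends r s (psiTwo ends r s d ω) := by
  have hx' : x ∈ Sw ends r s d ω := by
    rcases mem_K2_iff.1 hx with hc | hc
    · exact mem_of_conn_of_closed (Sw_closed h) (Or.inl (r_mem_K2 _)) hc
    · exact mem_of_conn_of_closed (Sw_closed h) (Or.inl (s_mem_K2 _)) hc
  rcases hx' with hx' | hx' | hx'
  · exact hx'
  · exact (not_mem_K2_of_mem_Mcore h.done hx' hx).elim
  · exact (hx'.1 hx).elim

/-- **`d ∈ K₂(Ψ₂ ω)`.** -/
theorem mem_K2_psiTwo : d ∈ K2 ends r s (psiTwo ends r s d ω) :=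
  mem_K2_psiTwo_of_mem_K2 h h.inK

/-- A vertex outside both worlds of `ω` is outside `Zw`. -/
lemma not_mem_Zw_of_out {x : V} (hxK : x ∉ K2 ends r s ω) (hxM : x ∉ M2 ends r s ω) :
    x ∉ Zw ends r s d ω := by
  rintro ((hT | hK) | hF)
  · simp only [Set.mem_insert_iff, Set.mem_singleton_iff] at hT
    rcases hT with rfl | rfl | rfl
    · exact hxK (r_mem_K2 ω)
    · exact hxK (s_mem_K2 ω)
    · exact hxK h.inK
  · exact hxK hK.1
  · exact hxM (flipSetW_subset_Mcore hF).1

omit h in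
/-- A vertex outside the `W`-world of `ω` is outside `Tw`. -/
lemma not_mem_Tw_of_out {x : V} (hxM : x ∉ M2 ends r s ω) : x ∉ Tw ends r s d ω := by
  rintro (hT | ⟨hM, _⟩)
  · simp only [Set.mem_insert_iff, Set.mem_singleton_iff] at hT
    rcases hT with rfl | rfl
    · exact hxM (r_mem_M2 ω)
    · exact hxM (s_mem_M2 ω)
  · exact hxM hM.1

/-- **`Ψ₂ ω` is `Sep`.** -/
theorem sep2_psiTwo : sep2 ends p q r s (psiTwo ends r s d ω) := by
  obtain ⟨⟨hpr, hps, hqr, hqs⟩, ⟨hpr', hps', hqr', hqs'⟩⟩ := h.sep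
  have hpK : p ∉ K2 ends r s ω := fun hp => by
    rcases mem_K2_iff.1 hp with hc | hc
    · exact hpr (conn_symm hc)
    · exact hps (conn_symm hc)
  have hqK : q ∉ K2 ends r s ω := fun hq => by
    rcases mem_K2_iff.1 hq with hc | hc
    · exact hqr (conn_symm hc)
    · exact hqs (conn_symm hc)
  have hpM : p ∉ M2 ends r s ω := fun hp => by
    rcases mem_M2_iff.1 hp with hc | hc
    · exact hpr' (conn_symm hc)
    · exact hps' (conn_symm hc)
  have hqM : q ∉ M2 ends r s ω := fun hq => by
    rcases mem_M2_iff.1 hq with hc | hc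
    · exact hqr' (conn_symm hc)
    · exact hqs' (conn_symm hc)
  have hpK' : p ∉ K2 ends r s (psiTwo ends r s d ω) :=
    fun hp => not_mem_Zw_of_out h hpK hpM (K2_psiTwo_subset h hp)
  have hqK' : q ∉ K2 ends r s (psiTwo ends r s d ω) :=
    fun hq => not_mem_Zw_of_out h hqK hqM (K2_psiTwo_subset h hq)
  have hpM' : p ∉ M2 ends r s (psiTwo ends r s d ω) :=
    fun hp => not_mem_Tw_of_out hpM (M2_psiTwo_subset h hp)
  have hqM' : q ∉ M2 ends r s (psiTwo ends r s d ω) :=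
    fun hq => not_mem_Tw_of_out hqM (M2_psiTwo_subset h hq)
  refine ⟨⟨?_, ?_, ?_, ?_⟩, ⟨?_, ?_, ?_, ?_⟩⟩
  · exact fun hc => hpK' (mem_K2_iff.2 (Or.inl (conn_symm hc)))
  · exact fun hc => hpK' (mem_K2_iff.2 (Or.inr (conn_symm hc)))
  · exact fun hc => hqK' (mem_K2_iff.2 (Or.inl (conn_symm hc)))
  · exact fun hc => hqK' (mem_K2_iff.2 (Or.inr (conn_symm hc)))
  · exact fun hc => hpM' (mem_M2_iff.2 (Or.inl (conn_symm hc)))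
  · exact fun hc => hpM' (mem_M2_iff.2 (Or.inr (conn_symm hc)))
  · exact fun hc => hqM' (mem_M2_iff.2 (Or.inl (conn_symm hc)))
  · exact fun hc => hqM' (mem_M2_iff.2 (Or.inr (conn_symm hc)))

/-- **`Ψ₂ ω` is `DZero`** (no vertex other than `r, s` in both worlds). -/
theorem DZero_psiTwo : DZero ends r s (psiTwo ends r s d ω) := by
  intro x hxr hxs hxK hxM
  rcases M2_psiTwo_subset h hxM with hT | ⟨hM, hF⟩
  · simp only [Set.mem_insert_iff, Set.mem_singleton_iff] at hT
    rcases hT with rfl | rfl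
    · exact hxr rfl
    · exact hxs rfl
  · rcases K2_psiTwo_subset h hxK with (hT | hK) | hF'
    · simp only [Set.mem_insert_iff, Set.mem_singleton_iff] at hT
      rcases hT with rfl | rfl | rfl
      · exact hxr rfl
      · exact hxs rfl
      · exact d_not_mem_Mcore hM
    · exact not_mem_Mcore_of_mem_Kcore h.done hK hM
    · exact hF hF'

/-- **`Ψ₂ ω` is `DOne(d)`.** -/
theorem DOne_psiTwo : DOne ends r s d (psiTwo ends r s d ω) :=
  fun x hxr hxs _ hxK => DZero_psiTwo h x hxr hxs hxK

end Worlds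

end NoPocket

end Summit.Ventures.PercRepro2
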